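import Mathlib
import Summits.NavierStokesRegularity.NavierStokesRegularity.Theorems.TaoLadderRungTwoBreakOneShiftBanach
import Summits.NavierStokesRegularity.NavierStokesRegularity.Theorems.TaoLadderRungThreeGappedFrontRobustComparison
import HarnessLib

/-!
# Kernel STAGE 3, tail rows: the Picard–shift estimates of the one-shift map from shell-wise bounds, and the
# refined end-to-end statement (cell harvest/h2-tao-ladder, seat p2; rung1/KERNEL-STAGE3-PLAN.md; support for
# K1(1) = `NoSurvivingDSSOne`, stmt-NavierStokesRegularity-20205)

MODEL lattice ODEs only (Tao 2016 §4 on Tao's shift set `S`); nothing here is a statement about the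
Navier–Stokes equations; no item is closed; CONDITIONAL glue.

`…OneShiftBanach` (p622006) proves the end-to-end statement with the two TAIL hypotheses in solved form
(time-Lipschitz raw tails; raw scaled tails `q`-Lipschitz). This file derives both from shell-wise data, which
is where STAGE3-BANACH §2's relations (r2)/(r5)/(o3)/(o4) live:
* `tailRaw_time_lipschitz` — rate bounds `|quadTerm_{i,k}(S)| ≤ R_k` along the flight ⟹ `|tailRaw(t) −
  tailRaw(s)| ≤ R_k |t − s|` (integral of a bounded continuous integrand);
* `quadTermLip` — the shell-wise Lipschitz functional `Σ |α| (1+ε₀)^{5(k−μ₃)/2}(D_a A_b + A_a D_b)` and its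
  linearity in `D`;
* `tail_lipschitz_of_rows` — THE TAIL ROWS: for two points of the invariant set the raw scaled tail output at
  `(i,k,t)` differs by at most `q·dist` as soon as `g_hi P_{k+1} + A_{k+1} γ + τ_hi quadTermLip(A,D′)(i,k) ≤
  q wt_k` (one-shift partner through a moving flight time + renormalisation factor + Picard integral via the
  tree's bilinear bound `GappedFrontRobust.abs_quadTerm_sub_quadTerm_le`); tail distances are `wt_{k′}·dist`
  (`abs_decodeTail_sub_le`), window distances and `γ`, `Z₀` are the engine's (H-lip) data;
* `exists_surviving_dssWave_of_windowCert_rows` — the refined end-to-end theorem.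
-/

noncomputable section

-- `Summit.NavierStokesRegularity.NavierStokesRegularity.…` is the tree's (summit = problem) namespace; the
-- duplicated component is intended, so the dupNamespace linter is silenced for this file.
set_option linter.dupNamespace false

namespace Summit.NavierStokesRegularity.NavierStokesRegularity.Theorems

namespace DSSOneShift

open Set MeasureTheory intervalIntegral
open Literature.Analysis.FluidPDE Literature.Analysis.FluidPDE.TaoCascade CertificateGlueOn

variable {m : ℕ}

namespace OneShiftFrame

variable (F : OneShiftFrame m)

/-! ### Tail estimates -/

/-- On an admissible point the raw Picard–shift value reads the DECODED data:
`tailRaw u i k t = g(z)·S_{i,k+1}(τ) + ∫_0^t quadTerm_{i,k}(S)` with `S = fullFamily`, `τ = decodeTau u`. [folklore] -/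
theorem tailRaw_eq {ε₀ : ℝ} {α : Fin m → Fin m → Fin m → ℤ × ℤ × ℤ → ℝ}
    (cert : OneShiftWindowCert F ε₀ α) {u : F.Space} (hu : F.Adm u) (i : Fin m) (k : ℤ) (t : ℝ) :
    F.tailRaw cert u i k t = gfac (slice (F.fullFamily cert u) (F.decodeTau u)) *
      F.fullFamily cert u i (k + 1) (F.decodeTau u) +
      ∫ s in (0 : ℝ)..t, quadTerm ε₀ α (F.fullFamily cert u) i k s := by
  unfold tailRaw; rw [F.preclampTau_eq_decodeTau hu]

/-- Every shell of the full family of an admissible point is continuous on the flight. [folklore] -/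
theorem continuousOn_fullFamily {ε₀ : ℝ} {α : Fin m → Fin m → Fin m → ℤ × ℤ × ℤ → ℝ}
    (cert : OneShiftWindowCert F ε₀ α) {u : F.Space} (hu : F.Adm u) (j : Fin m) (k : ℤ) :
    ContinuousOn (F.fullFamily cert u j k) (Icc 0 F.τhi) := by
  have hAdm := F.admData_decode hu
  have hS : F.fullFamily cert u = cert.Φ (F.decodeY u) (F.decodeTail u) := by
    unfold fullFamily; rw [F.preclampY_eq_decodeY hu, F.preclampTail_eq_decodeTail_fun hu]
  by_cases hk : F.InWindow k
  · have hrun := cert.Φ_run _ _ hAdm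
    rw [hS]; exact hrun.continuousOn j hk.1 (by have := hk.2; omega)
  · rw [hS, cert.Φ_tail _ _ j k hk]; exact hAdm.2.1 j k hk

/-- Tail shells of the full family ARE the decoded tails. [folklore] -/
theorem fullFamily_tail {ε₀ : ℝ} {α : Fin m → Fin m → Fin m → ℤ × ℤ × ℤ → ℝ}
    (cert : OneShiftWindowCert F ε₀ α) {u : F.Space} (hu : F.Adm u) (j : Fin m) {k : ℤ}
    (hk : ¬ F.InWindow k) : F.fullFamily cert u j k = F.decodeTail u j k := by
  unfold fullFamily
  rw [F.preclampY_eq_decodeY hu, F.preclampTail_eq_decodeTail_fun hu, cert.Φ_tail _ _ j k hk]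

/-- Decoded tails of two points differ by at most `wt_k · dist` pointwise. [folklore] -/
theorem abs_decodeTail_sub_le (u v : F.Space) (i : Fin m) (k : ℤ) (t : ℝ) :
    |F.decodeTail u i k t - F.decodeTail v i k t| ≤ F.wt k * dist u v := by
  unfold decodeTail
  rw [← mul_sub, abs_mul, abs_of_pos (F.wt_pos k)]
  refine mul_le_mul_of_nonneg_left ?_ (F.wt_pos k).le
  set p : F.TailIdx := (i, k, projIcc 0 F.τhi F.τhi_pos.le t)
  have h1 : |(u.2.2 : F.TailIdx → ℝ) p - (v.2.2 : F.TailIdx → ℝ) p| ≤ dist u.2.2 v.2.2 := by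
    have h := lp.norm_apply_le_norm ENNReal.top_ne_zero (u.2.2 - v.2.2) p
    rw [lp.coeFn_sub, Pi.sub_apply, Real.norm_eq_abs] at h
    rwa [dist_eq_norm]
  refine h1.trans ?_
  rw [Prod.dist_eq, Prod.dist_eq]
  exact le_trans (le_max_right _ _) (le_max_right _ _)

/-- Decoded flight times differ by at most `rτ · dist`. [folklore] -/
theorem abs_decodeTau_sub_le (u v : F.Space) : |F.decodeTau u - F.decodeTau v| ≤ F.rτ * dist u v := by
  unfold decodeTau
  rw [show F.τc + F.rτ * u.2.1 - (F.τc + F.rτ * v.2.1) = F.rτ * (u.2.1 - v.2.1) by ring, abs_mul,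
    abs_of_pos F.rτ_pos]
  refine mul_le_mul_of_nonneg_left ?_ F.rτ_pos.le
  rw [← Real.dist_eq, Prod.dist_eq, Prod.dist_eq]
  exact le_trans (le_max_left _ _) (le_max_right _ _)

/-- The decoded flight time of an admissible point lies in the flight interval. [folklore] -/
theorem decodeTau_mem {u : F.Space} (hu : F.Adm u) : F.decodeTau u ∈ Icc 0 F.τhi := by
  have h := hu.2.1; rw [abs_le] at h
  have hr := F.rτ_pos; have hc := F.τc_gt
  unfold decodeTau τhi
  constructor <;> nlinarith

/-- **TIME-LIPSCHITZ RAW TAILS from a rate bound** (the hypothesis `hrate` of `mapsTo_oneShiftMap`): if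
`|quadTerm_{i,k}(S_u)(s)| ≤ R_k` along the flight for every admissible `u`, then
`|tailRaw u i k t - tailRaw u i k s| ≤ R_k |t - s|`.
[cite: Tao2016AveragedNS, §4 Lemma 4.1 (4.8); cell vocabulary, harvest/h2-tao-ladder rung1/STAGE2-LEMMA.md §3 Lemma 5] -/
theorem tailRaw_time_lipschitz {ε₀ : ℝ} {α : Fin m → Fin m → Fin m → ℤ × ℤ × ℤ → ℝ}
    (cert : OneShiftWindowCert F ε₀ α) (R : ℤ → ℝ)
    (hR : ∀ u, F.Adm u → ∀ i k, ¬ F.InWindow k → ∀ s ∈ Icc 0 F.τhi,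
      |quadTerm ε₀ α (F.fullFamily cert u) i k s| ≤ R k)
    {u : F.Space} (hu : F.Adm u) (i : Fin m) {k : ℤ} (hk : ¬ F.InWindow k) {s t : ℝ}
    (hs : s ∈ Icc 0 F.τhi) (ht : t ∈ Icc 0 F.τhi) :
    |F.tailRaw cert u i k t - F.tailRaw cert u i k s| ≤ R k * |t - s| := by
  rw [F.tailRaw_eq cert hu, F.tailRaw_eq cert hu, add_sub_add_left_eq_sub]
  have hcont : ContinuousOn (fun x => quadTerm ε₀ α (F.fullFamily cert u) i k x) (Icc 0 F.τhi) :=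
    continuousOn_quadTerm (fun j k' => F.continuousOn_fullFamily cert hu j k') i k
  have hint : ∀ {a b : ℝ}, a ∈ Icc 0 F.τhi → b ∈ Icc 0 F.τhi →
      IntervalIntegrable (fun x => quadTerm ε₀ α (F.fullFamily cert u) i k x) volume a b :=
    fun ha hb => (hcont.mono (uIcc_subset_Icc ha hb)).intervalIntegrable
  have h0 : (0 : ℝ) ∈ Icc 0 F.τhi := left_mem_Icc.2 F.τhi_pos.le
  rw [intervalIntegral.integral_interval_sub_left (hint h0 ht) (hint h0 hs)]
  have hb : ∀ x ∈ Set.uIoc s t, ‖quadTerm ε₀ α (F.fullFamily cert u) i k x‖ ≤ R k := by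
    intro x hx
    rw [Real.norm_eq_abs]
    refine hR u hu i k hk x ?_
    have hx' : x ∈ uIcc s t := uIoc_subset_uIcc hx
    exact uIcc_subset_Icc hs ht hx'
  exact intervalIntegral.norm_integral_le_of_norm_le_const hb

/-- The shell-wise Lipschitz functional of the quadratic field at shell `k`, output mode `i`, for amplitude
bounds `A` and distance coefficients `D`:
`Σ_{i₁,i₂,μ∈S} |α_{i₁i₂iμ}| (1+ε₀)^{5(k-μ₃)/2} (D_a A_b + A_a D_b)` (`a = k-μ₃+μ₁`, `b = k-μ₃+μ₂`).
[cite: Tao2016AveragedNS, §4 (4.8) (the bilinear term); cell vocabulary, harvest/h2-tao-ladder rung1/STAGE3-BANACH.md §2 (Lip(k ← k′))] -/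
def quadTermLip (ε₀ : ℝ) (α : Fin m → Fin m → Fin m → ℤ × ℤ × ℤ → ℝ) (A D : ℤ → ℝ) (i : Fin m)
    (k : ℤ) : ℝ :=
  ∑ i₁ : Fin m, ∑ i₂ : Fin m, ∑ μ ∈ shiftSet, |α i₁ i₂ i μ| * (1 + ε₀) ^ ((5 : ℝ) * (k - μ.2.2) / 2) *
    (D (k - μ.2.2 + μ.1) * A (k - μ.2.2 + μ.2.1) + A (k - μ.2.2 + μ.1) * D (k - μ.2.2 + μ.2.1))

/-- The Lipschitz functional is linear in `D`. [folklore] -/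
theorem quadTermLip_smul (ε₀ : ℝ) (α : Fin m → Fin m → Fin m → ℤ × ℤ × ℤ → ℝ) (A D : ℤ → ℝ)
    (d : ℝ) (i : Fin m) (k : ℤ) :
    quadTermLip ε₀ α A (fun k' => D k' * d) i k = quadTermLip ε₀ α A D i k * d := by
  unfold quadTermLip
  rw [Finset.sum_mul]; refine Finset.sum_congr rfl fun i₁ _ => ?_
  rw [Finset.sum_mul]; refine Finset.sum_congr rfl fun i₂ _ => ?_
  rw [Finset.sum_mul]; refine Finset.sum_congr rfl fun μ _ => ?_
  ring

/-- **THE TAIL ROWS OF STAGE 3's MATRIX, in the kernel.** For two points of the invariant set, the raw scaled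
tail output at a tail index `(i, k, t)` differs by at most `q · dist`, provided the ROW INEQUALITY
`g_hi · P_{k+1} + A_{k+1} · γ + τ_hi · quadTermLip(A, D′)(i, k) ≤ q · wt_k` holds, where `P_{k+1}` is the
one-shift partner's Lipschitz constant (`wt_{k+1} + R_{k+1} rτ` for a tail partner — time-Lipschitz tails at a
moving flight time; `Z₀` for the window bottom `k+1 = 0`), `A` are amplitude bounds on the flight, `γ` the
Lipschitz constant of the renormalisation factor, and `D′_{k′} = wt_{k′}` on tail shells / the window Lipschitz
constants on window shells. Window-side constants (`γ`, `Z₀`, `Dwin`, the window amplitudes) are hypotheses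
(the engine's (H-lip) data); the tail side is derived (`abs_decodeTail_sub_le`, the time-Lipschitz clause,
p1-style bilinear bound `GappedFrontRobust.abs_quadTerm_sub_quadTerm_le`).
[cite: Tao2016AveragedNS, §4 (4.8); cell vocabulary, harvest/h2-tao-ladder rung1/STAGE3-BANACH.md §2 ((r2), (r5), (o3), (o4))] -/
theorem tail_lipschitz_of_rows {ε₀ : ℝ} {α : Fin m → Fin m → Fin m → ℤ × ℤ × ℤ → ℝ}
    (cert : OneShiftWindowCert F ε₀ α) (hε : 0 < 1 + ε₀) (R A Dwin : ℤ → ℝ) {gHi γ Z0 q : ℝ}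
    (hR0 : ∀ k, 0 ≤ R k) {u v : F.Space} (hu : F.AdmLip R u) (hv : F.AdmLip R v)
    (hA : ∀ w, F.Adm w → ∀ j k', ∀ s ∈ Icc 0 F.τhi, |F.fullFamily cert w j k' s| ≤ A k')
    (hg0 : ∀ w, F.Adm w → 0 ≤ gfac (slice (F.fullFamily cert w) (F.decodeTau w)) ∧
      gfac (slice (F.fullFamily cert w) (F.decodeTau w)) ≤ gHi)
    (hγ : |gfac (slice (F.fullFamily cert u) (F.decodeTau u)) -
      gfac (slice (F.fullFamily cert v) (F.decodeTau v))| ≤ γ * dist u v)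
    (hZ0 : ∀ i, |F.fullFamily cert u i 0 (F.decodeTau u) - F.fullFamily cert v i 0 (F.decodeTau v)| ≤
      Z0 * dist u v)
    (hDwin : ∀ j k', F.InWindow k' → ∀ s ∈ Icc 0 F.τhi,
      |F.fullFamily cert u j k' s - F.fullFamily cert v j k' s| ≤ Dwin k' * dist u v)
    (hrow : ∀ i k, ¬ F.InWindow k →
      gHi * (if F.InWindow (k + 1) then Z0 else F.wt (k + 1) + R (k + 1) * F.rτ) + A (k + 1) * γ +
        F.τhi * quadTermLip ε₀ α A (fun k' => if F.InWindow k' then Dwin k' else F.wt k') i k ≤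
        q * F.wt k)
    (p : F.TailIdx) (hk : ¬ F.InWindow p.2.1) :
    |F.rawTailScaled cert u p - F.rawTailScaled cert v p| ≤ q * dist u v := by
  obtain ⟨i, k, ⟨t, ht⟩⟩ := p
  simp only at hk
  set Su := F.fullFamily cert u with hSu
  set Sv := F.fullFamily cert v with hSv
  set gu := gfac (slice Su (F.decodeTau u))
  set gv := gfac (slice Sv (F.decodeTau v))
  set d := dist u v with hd
  have hd0 : 0 ≤ d := dist_nonneg
  have hwk := F.wt_pos k
  have hτu := F.decodeTau_mem hu.1
  have hτv := F.decodeTau_mem hv.1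
  -- the difference, unscaled
  unfold rawTailScaled
  simp only
  rw [← sub_div, abs_div, abs_of_pos hwk, div_le_iff₀ hwk, F.tailRaw_eq cert hu.1, F.tailRaw_eq cert hv.1]
  -- (1) the one-shift partner term
  have hpartner : |gu * Su i (k + 1) (F.decodeTau u) - gv * Sv i (k + 1) (F.decodeTau v)| ≤
      (gHi * (if F.InWindow (k + 1) then Z0 else F.wt (k + 1) + R (k + 1) * F.rτ) + A (k + 1) * γ) * d := by
    have hid : gu * Su i (k + 1) (F.decodeTau u) - gv * Sv i (k + 1) (F.decodeTau v) =
        (gu - gv) * Su i (k + 1) (F.decodeTau u) +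
          gv * (Su i (k + 1) (F.decodeTau u) - Sv i (k + 1) (F.decodeTau v)) := by ring
    rw [hid]
    have hAu := hA u hu.1 i (k + 1) _ hτu
    obtain ⟨hgv0, hgv1⟩ := hg0 v hv.1
    have hdiff : |Su i (k + 1) (F.decodeTau u) - Sv i (k + 1) (F.decodeTau v)| ≤
        (if F.InWindow (k + 1) then Z0 else F.wt (k + 1) + R (k + 1) * F.rτ) * d := by
      split_ifs with hk1
      · have hk0 : k + 1 = 0 := by
          unfold InWindow at hk hk1; omega
        rw [hk0]; exact hZ0 i
      · -- tail partner: through `τ_u` then along `v`'s time-Lipschitz clause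
        have e1 : Su i (k + 1) = F.decodeTail u i (k + 1) := F.fullFamily_tail cert hu.1 i hk1
        have e2 : Sv i (k + 1) = F.decodeTail v i (k + 1) := F.fullFamily_tail cert hv.1 i hk1
        rw [e1, e2]
        have h1 := F.abs_decodeTail_sub_le u v i (k + 1) (F.decodeTau u)
        have h2 := hv.2 i (k + 1) hk1 (F.decodeTau v) hτv (F.decodeTau u) hτu
        have h3 := F.abs_decodeTau_sub_le u v
        calc |F.decodeTail u i (k + 1) (F.decodeTau u) - F.decodeTail v i (k + 1) (F.decodeTau v)|
            ≤ |F.decodeTail u i (k + 1) (F.decodeTau u) - F.decodeTail v i (k + 1) (F.decodeTau u)| +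
              |F.decodeTail v i (k + 1) (F.decodeTau u) - F.decodeTail v i (k + 1) (F.decodeTau v)| :=
              abs_sub_le _ _ _
          _ ≤ F.wt (k + 1) * d + R (k + 1) * |F.decodeTau u - F.decodeTau v| := add_le_add h1 h2
          _ ≤ F.wt (k + 1) * d + R (k + 1) * (F.rτ * d) := by
              have := mul_le_mul_of_nonneg_left h3 (hR0 (k + 1)); linarith
          _ = (F.wt (k + 1) + R (k + 1) * F.rτ) * d := by ring
    have hcoef : 0 ≤ (if F.InWindow (k + 1) then Z0 else F.wt (k + 1) + R (k + 1) * F.rτ) * d :=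
      (abs_nonneg _).trans hdiff
    calc |(gu - gv) * Su i (k + 1) (F.decodeTau u) + gv * (Su i (k + 1) (F.decodeTau u) - Sv i (k + 1) (F.decodeTau v))|
        ≤ |gu - gv| * |Su i (k + 1) (F.decodeTau u)| + |gv| * |Su i (k + 1) (F.decodeTau u) - Sv i (k + 1) (F.decodeTau v)| := by
          rw [← abs_mul, ← abs_mul]; exact abs_add_le _ _
      _ ≤ γ * d * A (k + 1) + gHi * ((if F.InWindow (k + 1) then Z0 else F.wt (k + 1) + R (k + 1) * F.rτ) * d) := by
          refine add_le_add (mul_le_mul hγ hAu (abs_nonneg _) (by nlinarith [(abs_nonneg _).trans hγ])) ?_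
          rw [abs_of_nonneg hgv0]
          exact mul_le_mul hgv1 hdiff (abs_nonneg _) (hgv0.trans hgv1)
      _ = (gHi * (if F.InWindow (k + 1) then Z0 else F.wt (k + 1) + R (k + 1) * F.rτ) + A (k + 1) * γ) * d := by ring
  -- (2) the Picard term
  set D' : ℤ → ℝ := fun k' => if F.InWindow k' then Dwin k' else F.wt k'
  have hLq : ∀ s ∈ Icc 0 F.τhi, |quadTerm ε₀ α Su i k s - quadTerm ε₀ α Sv i k s| ≤
      quadTermLip ε₀ α A D' i k * d := by
    intro s hs
    have h := GappedFrontRobust.abs_quadTerm_sub_quadTerm_le ε₀ hε α Su Sv i k s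
      (A := A) (D := fun k' => D' k' * d) (fun j k' => hA u hu.1 j k' s hs) (fun j k' => hA v hv.1 j k' s hs)
      (fun j k' => by
        show |Su j k' s - Sv j k' s| ≤ D' k' * d
        by_cases hk' : F.InWindow k'
        · simp only [D', if_pos hk']; exact hDwin j k' hk' s hs
        · simp only [D', if_neg hk']
          rw [hSu, hSv, F.fullFamily_tail cert hu.1 j hk', F.fullFamily_tail cert hv.1 j hk']
          exact F.abs_decodeTail_sub_le u v j k' s)
    rw [← quadTermLip_smul]
    exact h
  have hcu : ContinuousOn (fun x => quadTerm ε₀ α Su i k x) (Icc 0 F.τhi) :=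
    continuousOn_quadTerm (fun j k' => F.continuousOn_fullFamily cert hu.1 j k') i k
  have hcv : ContinuousOn (fun x => quadTerm ε₀ α Sv i k x) (Icc 0 F.τhi) :=
    continuousOn_quadTerm (fun j k' => F.continuousOn_fullFamily cert hv.1 j k') i k
  have h0 : (0 : ℝ) ∈ Icc 0 F.τhi := left_mem_Icc.2 F.τhi_pos.le
  have hiu : IntervalIntegrable (fun x => quadTerm ε₀ α Su i k x) volume 0 t :=
    (hcu.mono (uIcc_subset_Icc h0 ht)).intervalIntegrable
  have hiv : IntervalIntegrable (fun x => quadTerm ε₀ α Sv i k x) volume 0 t :=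
    (hcv.mono (uIcc_subset_Icc h0 ht)).intervalIntegrable
  have hpicard : |(∫ s in (0 : ℝ)..t, quadTerm ε₀ α Su i k s) - ∫ s in (0 : ℝ)..t, quadTerm ε₀ α Sv i k s| ≤
      F.τhi * quadTermLip ε₀ α A D' i k * d := by
    rw [← intervalIntegral.integral_sub hiu hiv]
    have hb : ∀ x ∈ Set.uIoc (0 : ℝ) t, ‖quadTerm ε₀ α Su i k x - quadTerm ε₀ α Sv i k x‖ ≤ quadTermLip ε₀ α A D' i k * d := by
      intro x hx
      rw [Real.norm_eq_abs]
      exact hLq x (uIcc_subset_Icc h0 ht (uIoc_subset_uIcc hx))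
    have h := intervalIntegral.norm_integral_le_of_norm_le_const hb
    rw [Real.norm_eq_abs, sub_zero, abs_of_nonneg ht.1] at h
    have hL0 : 0 ≤ quadTermLip ε₀ α A D' i k * d := (abs_nonneg _).trans (hLq 0 h0)
    calc |∫ x in (0 : ℝ)..t, quadTerm ε₀ α Su i k x - quadTerm ε₀ α Sv i k x|
        ≤ quadTermLip ε₀ α A D' i k * d * t := h
      _ ≤ quadTermLip ε₀ α A D' i k * d * F.τhi := mul_le_mul_of_nonneg_left ht.2 hL0
      _ = F.τhi * quadTermLip ε₀ α A D' i k * d := by ring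
  -- (3) sum and compare with the row inequality
  have hrow' := hrow i k hk
  have hsplit : gu * Su i (k + 1) (F.decodeTau u) + (∫ s in (0 : ℝ)..t, quadTerm ε₀ α Su i k s) -
      (gv * Sv i (k + 1) (F.decodeTau v) + ∫ s in (0 : ℝ)..t, quadTerm ε₀ α Sv i k s) =
      (gu * Su i (k + 1) (F.decodeTau u) - gv * Sv i (k + 1) (F.decodeTau v)) +
        ((∫ s in (0 : ℝ)..t, quadTerm ε₀ α Su i k s) - ∫ s in (0 : ℝ)..t, quadTerm ε₀ α Sv i k s) := by ring
  rw [hsplit]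
  refine (abs_add_le _ _).trans ?_
  calc _ ≤ (gHi * (if F.InWindow (k + 1) then Z0 else F.wt (k + 1) + R (k + 1) * F.rτ) + A (k + 1) * γ) * d +
        F.τhi * quadTermLip ε₀ α A D' i k * d := add_le_add hpartner hpicard
    _ = (gHi * (if F.InWindow (k + 1) then Z0 else F.wt (k + 1) + R (k + 1) * F.rτ) + A (k + 1) * γ +
        F.τhi * quadTermLip ε₀ α A D' i k) * d := by ring
    _ ≤ (q * F.wt k) * d := mul_le_mul_of_nonneg_right hrow' hd0
    _ = q * dist u v * F.wt k := by rw [hd]; ring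


/-- **KERNEL STAGE 3, refined end-to-end statement: WINDOW-SIDE DATA + SHELL-WISE TABLE ARITHMETIC ⟹
NON-TRIVIAL (S₁)-SURVIVING ADMISSIBLE DSS WAVE.** As `exists_surviving_dssWave_of_windowCert` (p622006), but
the two tail hypotheses are DERIVED: the time-Lipschitz raw tails from the rate bounds `R` of the quadratic
field on the flight (`tailRaw_time_lipschitz`), and the tail rows of the contraction from the row
inequalities `g_hi P_{k+1} + A_{k+1} γ + τ_hi quadTermLip(A, D′)(i,k) ≤ q wt_k` (`tail_lipschitz_of_rows`).
What remains hypothesis: the window certificate; the window-side Lipschitz data in solved form (raw window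
block `q`-Lipschitz; `γ`, `Z₀`, `Dwin`); amplitude bounds `A` along the flight; rate bounds `R ≥ 0`; the
renormalisation-factor enclosure; clamps inactive ((H-win), STAGE 2 Lemma 4); the frame inequalities; a
point of the invariant set — i.e. the engine's certified numbers and table arithmetic on the tubes.
[cite: Tao2016AveragedNS, §4 Lemma 4.1 (4.8), §5.3–§6; cell vocabulary, harvest/h2-tao-ladder rung1/STAGE2-LEMMA.md, rung1/STAGE3-BANACH.md, rung1/KERNEL-STAGE3-PLAN.md] -/
theorem exists_surviving_dssWave_of_windowCert_rows {ε₀ Mα Q β C₀ ϱ q gHi γ Z0 : ℝ}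
    {α : Fin m → Fin m → Fin m → ℤ × ℤ × ℤ → ℝ} (cert : OneShiftWindowCert F ε₀ α) (R A Dwin : ℤ → ℝ)
    (hε : 0 < 1 + ε₀) (hMα : 0 ≤ Mα) (hα : ∀ i₁ i₂ i₃ μ, |α i₁ i₂ i₃ μ| ≤ Mα) (hW1 : 1 ≤ F.W)
    (hq : 0 ≤ q) (hq1 : q < 1) (hR0 : ∀ k, 0 ≤ R k)
    (hR : ∀ u, F.Adm u → ∀ i k, ¬ F.InWindow k → ∀ s ∈ Icc 0 F.τhi,
      |quadTerm ε₀ α (F.fullFamily cert u) i k s| ≤ R k)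
    (hA : ∀ w, F.Adm w → ∀ j k', ∀ s ∈ Icc 0 F.τhi, |F.fullFamily cert w j k' s| ≤ A k')
    (hg0 : ∀ w, F.Adm w → 0 ≤ gfac (slice (F.fullFamily cert w) (F.decodeTau w)) ∧
      gfac (slice (F.fullFamily cert w) (F.decodeTau w)) ≤ gHi)
    (hγ : ∀ u v, F.AdmLip R u → F.AdmLip R v →
      |gfac (slice (F.fullFamily cert u) (F.decodeTau u)) -
        gfac (slice (F.fullFamily cert v) (F.decodeTau v))| ≤ γ * dist u v)
    (hZ0 : ∀ u v, F.AdmLip R u → F.AdmLip R v → ∀ i,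
      |F.fullFamily cert u i 0 (F.decodeTau u) - F.fullFamily cert v i 0 (F.decodeTau v)| ≤ Z0 * dist u v)
    (hDwin : ∀ u v, F.AdmLip R u → F.AdmLip R v → ∀ j k', F.InWindow k' → ∀ s ∈ Icc 0 F.τhi,
      |F.fullFamily cert u j k' s - F.fullFamily cert v j k' s| ≤ Dwin k' * dist u v)
    (hrow : ∀ i k, ¬ F.InWindow k →
      gHi * (if F.InWindow (k + 1) then Z0 else F.wt (k + 1) + R (k + 1) * F.rτ) + A (k + 1) * γ +
        F.τhi * quadTermLip ε₀ α A (fun k' => if F.InWindow k' then Dwin k' else F.wt k') i k ≤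
        q * F.wt k)
    (hW : ∀ u v, F.AdmLip R u → F.AdmLip R v →
      dist (F.rawWindow cert u) (F.rawWindow cert v) ≤ q * dist u v)
    (h0 : ∃ u, F.AdmLip R u)
    (hwinIn : ∀ u, F.AdmLip R u →
      (∀ i k, |(F.rawWindow cert u).1 i k| ≤ 1) ∧ |(F.rawWindow cert u).2| ≤ 1)
    (htailIn : ∀ u, F.AdmLip R u → ∀ i k, ¬ F.InWindow k → ∀ t ∈ Icc 0 F.τhi,
      |F.tailRaw cert u i k t - F.tubeC i k| ≤ F.tubeR k)
    (hg : ∀ u, F.AdmLip R u →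
      1 < gfac (slice (F.fullFamily cert u) (F.decodeTau u)) ^ 2 ∧
        gfac (slice (F.fullFamily cert u) (F.decodeTau u)) ^ 2 ≤ 1 + ε₀ ∧
        gfac (slice (F.fullFamily cert u) (F.decodeTau u)) < bigLam ε₀ ∧
        β ^ 2 < gfac (slice (F.fullFamily cert u) (F.decodeTau u)) * bigLam ε₀)
    (hQ : 0 ≤ Q) (hβ1 : 1 ≤ β)
    (hwakeTube : ∀ i (n : ℕ), 1 ≤ n → |F.tubeC i (-(n : ℤ))| + F.tubeR (-(n : ℤ)) ≤ Q * β ^ n)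
    (hhull0 : ∀ u, F.AdmLip R u → ∀ i, ∀ s ∈ Icc 0 F.τhi, |F.fullFamily cert u i 0 s| ≤ Q)
    (hϱ : 0 < ϱ) (hϱ1 : ϱ * bigLam ε₀ < 1) (hC₀ : 0 ≤ C₀)
    (htopTube : ∀ i (j : ℕ), |F.tubeC i ((F.W : ℤ) + j)| + F.tubeR ((F.W : ℤ) + j) ≤ C₀ * ϱ ^ (F.W + j))
    (hne : ∃ i, F.a i 0 < |F.yc i 0|) :
    ∃ (T : ℝ) (Φ : Unit → ℝ → Em m), 0 < T ∧ IsDSSWave ε₀ α (Equiv.refl Unit) T Φ ∧ Surviving 1 ε₀ T ∧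
      ∃ x, Φ () x ≠ 0 :=
  F.exists_surviving_dssWave_of_windowCert cert R hε hMα hα hW1 hq hq1
    (fun _ hu i _ hk _ hs _ ht => F.tailRaw_time_lipschitz cert R hR hu.1 i hk hs ht)
    hW
    (fun u v hu hv p hp => F.tail_lipschitz_of_rows cert hε R A Dwin hR0 hu hv hA hg0 (hγ u v hu hv)
      (hZ0 u v hu hv) (hDwin u v hu hv) hrow p hp)
    h0 hwinIn htailIn hg hQ hβ1 hwakeTube hhull0 hϱ hϱ1 hC₀ htopTube hne


end OneShiftFrame

end DSSOneShift

end Summit.NavierStokesRegularity.NavierStokesRegularity.Theorems
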